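import Literature.Computability.QuantumComplexity.SimonSamplerBricks
import Literature.Computability.QuantumComplexity.ForrelationMemEval
import Literature.Computability.QuantumComplexity.PhaseQueryKernel
import HarnessLib

/-!
# Simon's algorithm inside a phase-query family, II: the phase machine, its specification, the single-query shape

Second file (after `SimonSamplerBricks.lean`) of the quantum half of the discharge of
`Literature.Computability.Complexity.fortnowGrochow_Ker_eq_PEq_UP_subset_BQP` (Fortnow–Grochow 2011,
Thm. 4.3 via Simon's algorithm). Following the template `ForrelationMemSpec.lean` word for word, the
mode-multiplexed function `SimonSampler.Fn F` of the phase machine is the dispatch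
(`ForrMem.dispatchF`, with the field bricks `xF`, `qcF`, `jF`, `q0F/q1F/q2F` of
`ForrelationMemFields.lean`) over

* mode `W`: `GwS = 1^{|0^W field|}` (as many active query wires as the zero padding of the input),
* mode `K`: `GkS = 1 1` (two active Hadamard layers: the `1`-fold Forrelation circuit
  `H^{⊗W} U_G H^{⊗W}`, Aaronson–Ambainis §3.2, Fig. 2 with `k = 1`),
* mode `P`: `GphaseS F` of `SimonSamplerBricks.lean` (phase only in layer `1`),
* mode `Z`: the zero test `ForrMem.GzF` (unused by the sampler, required by the interface);

it is in `FP` (`Fn_mem_FP`), whence a machine (`exists_machine`), the parameters `params hF`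
(`cW = 8`, `cL = 0`) and the specification `spec hF : Spec (params hF)` (`Fn_wd`, the four equations
on data words) — so that all of `PhaseQuery*.lean` applies: `PhaseQuery.family (params hF)` is a
uniform, oracle-free Clifford+`T` family. On a genuine padded input `xcode a Q r m W`:
`Wv = W` (`Wv_spec_xcode`), `Kv = 2`, the phase predicate is `[j = 1] ∧ Gbit F a Q r m u`
(`Pf_xcode`), and the input is a single-query specification in the sense of `PhaseQueryKernel.lean`
(`onePhaseAt_xcode`), whose final block state is therefore the Fourier-sampling state
`H^{⊗W} D_G H^{⊗W} |0⟩`.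

## References

* L. Fortnow, J. A. Grochow, *Complexity classes of equivalence problems revisited*, Inform. and
  Comput. 209 (2011) = arXiv:0907.4775, Thm. 4.3 [FortnowGrochow2011].
* D. R. Simon, *On the power of quantum computation*, SIAM J. Comput. 26 (1997), §3.1 [Simon1997].
* S. Aaronson, A. Ambainis, *Forrelation*, SIAM J. Comput. 47 (2018), §3.2 (Fig. 2), §6 (p. 26)
  [AaronsonAmbainis2018].
* S. Arora, B. Barak, *Computational Complexity: A Modern Approach*, CUP 2009, §1.3 [AroraBarak2009].
-/

noncomputable section

namespace Literature.Computability.QuantumComplexity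

open _root_.Computability Polynomial Complexity Complexity.Brick Plumb

namespace SimonSampler

open PhaseQuery ForrMem

variable (F : List Bool → List Bool) (hF : F ∈ FP)

/-! ### The function of the phase machine -/

/-- Mode `W`: as many active query wires as the zero padding of the input (`W`). [folklore] -/
def GwS : List Bool → List Bool := onesFn ∘ sndPow 3
/-- Mode `K`: two active Hadamard layers. [cite: AaronsonAmbainis2018, §3.2 (Fig. 2, k = 1)] -/
def GkS : List Bool → List Bool := fun _ => ones 2
/-- Mode `W` on the input field. [folklore] -/
def WmodeS : List Bool → List Bool := GwS ∘ xF
/-- Mode `K` on the input field. [folklore] -/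
def KmodeS : List Bool → List Bool := GkS ∘ xF
/-- Mode `P`: the phase function on `⟨x, ⟨register of the copy, layer register⟩⟩`. [folklore] -/
def PmodeS : List Bool → List Bool := GphaseS F ∘ fanoutFn xF (fanoutFn qcF jF)
/-- Mode `Z`: the zero test on the three registers (as for Forrelation). [folklore] -/
def ZmodeS : List Bool → List Bool := GzF ∘ fanoutFn q0F (fanoutFn q1F q2F)

/-- **The function of the Simon phase machine.** [cite: Simon1997, §3.1] [cite: AaronsonAmbainis2018, §6 (p. 26)] -/
def Fn : List Bool → List Bool := dispatchF WmodeS KmodeS (PmodeS F) ZmodeS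

variable {F}

/-- `GwS ∈ FP`, `GkS ∈ FP`. [folklore] -/
theorem GwS_mem_FP : GwS ∈ FP ∧ GkS ∈ FP := ⟨comp_mem_FP onesFn_mem_FP (sndPow_mem_FP 3), const_mem_FP _⟩

include hF in
/-- **`Fn F ∈ FP`.** [cite: AroraBarak2009, §1.3] -/
theorem Fn_mem_FP : Fn F ∈ FP :=
  dispatchF_mem_FP (comp_mem_FP GwS_mem_FP.1 xF_mem_FP) (comp_mem_FP GwS_mem_FP.2 xF_mem_FP)
    (comp_mem_FP (GphaseS_mem_FP hF) (fanoutFn_mem_FP xF_mem_FP (fanoutFn_mem_FP qcF_mem_FP jF_mem_FP)))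
    (comp_mem_FP GzF_mem_FP (fanoutFn_mem_FP q0F_mem_FP (fanoutFn_mem_FP q1F_mem_FP q2F_mem_FP)))

include hF in
/-- A machine computing `Fn F` in time `(n+2)^e`. [cite: AroraBarak2009, §1.3] -/
theorem exists_machine : ∃ (e : ℕ) (M : Turing.TM2ComputableAux Bool Bool), ∀ u : List Bool, M.OutputsWithin u (Fn F u) (RevSim.Tn e u.length) :=
  RevClean.exists_outputsWithin_pow_of_mem_FP (Fn_mem_FP hF)

/-- **The parameters of the Simon phase-query family**: `8` spare query wires, no spare layer, the
function `Fn F` and a machine for it. [cite: AaronsonAmbainis2018, §6 (p. 26)] -/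
def params (hF : F ∈ FP) : Params where
  cW := 8
  cL := 0
  Fn := Fn F
  e := Classical.choose (exists_machine hF)
  M := Classical.choose (Classical.choose_spec (exists_machine hF))
  hM := Classical.choose_spec (Classical.choose_spec (exists_machine hF))

/-- The constants of `params`. [folklore] -/
theorem params_consts : (params hF).cW = 8 ∧ (params hF).cL = 0 := ⟨rfl, rfl⟩

/-- `Ly params N = N`, `Wq params N = N + 8`. [folklore] -/
theorem Ly_params (N : ℕ) : Ly (params hF) N = N ∧ Wq (params hF) N = N + 8 := ⟨rfl, rfl⟩

/-! ### The specification -/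

/-- The phase predicate: input, register content, layer. [cite: Simon1997, §3.1] -/
def Pf (F : List Bool → List Bool) (x u : List Bool) (j : ℕ) : Bool := decide (GphaseS F (boolPair x (boolPair u (junary x.length j))) = [])

/-- **The four equations of `Fn` on data words.** [folklore] -/
theorem Fn_wd (x : List Bool) (q : ℕ → List Bool) (hq : ∀ c, (q c).length = Wq (params hF) x.length) (jv cv : List Bool)
    (hjv : jv.length = Ly (params hF) x.length) (hcv : cv.length = 2) :
    Fn F (wd x q jv cv [false, false]) = GwS x ∧ Fn F (wd x q jv cv [true, false]) = GkS x ∧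
    Fn F (wd x q jv cv [true, true]) = GzF (boolPair (q 0) (boolPair (q 1) (q 2))) ∧
    ∀ c, c < 3 → cv = ccode c → Fn F (wd x q jv cv [false, true]) = GphaseS F (boolPair x (boolPair (q c) jv)) := by
  obtain ⟨e1, e2, e3, e4⟩ := dispatchF_wd (params hF) x q jv hq hjv (params_consts hF) WmodeS KmodeS (PmodeS F) ZmodeS cv hcv
  refine ⟨?_, ?_, ?_, fun c hc hcc => ?_⟩
  · rw [Fn, e1, WmodeS, Function.comp_apply, xF_wd]
  · rw [Fn, e2, KmodeS, Function.comp_apply, xF_wd]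
  · obtain ⟨f0, f1, f2, -⟩ := qF_wd (params hF) x q jv cv [true, true] hq (params_consts hF)
    rw [Fn, e4, ZmodeS, Function.comp_apply, fanoutFn_apply, fanoutFn_apply, f0, f1, f2]
  · subst hcc
    rw [Fn, e3, PmodeS, Function.comp_apply, fanoutFn_apply, fanoutFn_apply, xF_wd, qcF_wd (params hF) x q jv hq hjv (params_consts hF) hc,
      jF_wd (params hF) x q jv (ccode c) [false, true] hq hjv (params_consts hF)]

/-- **The specification of the Simon phase machine.** [cite: Simon1997, §3.1] [cite: AaronsonAmbainis2018, §6 (p. 26)] -/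
def spec : Spec (params hF) where
  Wv x := (GwS x).length
  Kv x := (GkS x).length
  Pf := Pf F
  hW x := by
    show (Fn F (wd x _ _ _ _)).length = _
    rw [(Fn_wd hF x (fun _ => zeros (Wq (params hF) x.length)) (fun _ => by simp [zeros]) (zeros (Ly (params hF) x.length)) (zeros 2)
      (by simp [zeros]) (by simp [zeros])).1]
  hK x := by
    show (Fn F (wd x _ _ _ _)).length = _
    rw [(Fn_wd hF x (fun _ => zeros (Wq (params hF) x.length)) (fun _ => by simp [zeros]) (zeros (Ly (params hF) x.length)) (zeros 2)
      (by simp [zeros]) (by simp [zeros])).2.1]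
  hP x q hq j hj1 hjL c hc := by
    show Fn F (wd x _ _ _ _) = [] ↔ _
    rw [(Fn_wd hF x q hq (junary (Ly (params hF) x.length) j) (ccode c) (by simp [junary]; omega) (by simp [ccode])).2.2.2 c hc rfl, Pf,
      decide_eq_true_iff, (Ly_params hF x.length).1]
  hZ x q hq := by
    show Fn F (wd x _ _ _ _) = [] ↔ _
    rw [(Fn_wd hF x q hq (zeros (Ly (params hF) x.length)) (zeros 2) (by simp [zeros]) (by simp [zeros])).2.2.1, GzF_eq_nil_iff,
      hq 0, hq 1, hq 2]
    constructor
    · rintro ⟨h0, h1, h2⟩ c hc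
      interval_cases c <;> assumption
    · intro h; exact ⟨h 0 (by norm_num), h 1 (by norm_num), h 2 (by norm_num)⟩

/-! ### Genuine inputs: the single-query shape and the phase predicate -/

/-- `Kv = 2` everywhere. [folklore] -/
theorem Kv_spec (x : List Bool) : (spec hF).Kv x = 2 := rfl

/-- On a genuine input the number of active wires is the padding length `W`. [folklore] -/
theorem Wv_spec_xcode (a : List Bool) (Q r m W : ℕ) : (spec hF).Wv (xcode a Q r m W) = W := by
  show (GwS (xcode a Q r m W)).length = W
  simp [GwS, xcode, sndPow, onesFn, RevDesc.unaryEncodeNat_eq_replicate]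

/-- The length of a genuine input. [folklore] -/
theorem length_xcode (a : List Bool) (Q r m W : ℕ) : (xcode a Q r m W).length = 2 * a.length + 2 * Q + 2 * r + 2 * m + W + 8 := by
  simp [xcode, length_boolPair, ones]; ring

/-- **The phase predicate on a genuine input** with a layer `j`: set iff `j = 1` and the phase bit of the
register is set. [cite: Simon1997, §3.1] -/
theorem Pf_xcode (a : List Bool) (Q r m W : ℕ) (u : List Bool) (j : ℕ) :
    Pf F (xcode a Q r m W) u j = (decide (j = 1) && Gbit F a Q r m u) := by
  rw [Pf]
  have hL : 2 ≤ (xcode a Q r m W).length := by rw [length_xcode]; omega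
  by_cases h : j = 1 ∧ Gbit F a Q r m u = true
  · rw [decide_eq_true ((GphaseS_eq_nil_iff a Q r m W u j hL).2 h)]; obtain ⟨rfl, h2⟩ := h; simp [h2]
  · rw [decide_eq_false (fun h' => h ((GphaseS_eq_nil_iff a Q r m W u j hL).1 h'))]
    symm; simpa [Bool.and_eq_false_iff, not_and] using h

/-- **A genuine input yields a single-query specification** (two active layers, `W ≤ Wq` active wires,
no phase but in layer `1`). [cite: AaronsonAmbainis2018, §3.2 (Fig. 2, k = 1)] -/
theorem onePhaseAt_xcode (a : List Bool) (Q r m W : ℕ) : OnePhaseAt (params hF) (spec hF) (xcode a Q r m W) where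
  hK := rfl
  hLy := by rw [(Ly_params hF _).1, length_xcode]; omega
  hW := by rw [Wv_spec_xcode, (Ly_params hF _).2, length_xcode]; omega
  hPf u j hj := by
    show Pf F (xcode a Q r m W) u j = false
    rw [Pf_xcode]; simp; omega

end SimonSampler

end Literature.Computability.QuantumComplexity
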